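import Mathlib
import Summits.Ventures.PercRepro2.CoinChainXASixCellGen
import Summits.Ventures.PercRepro2.CoinChainXASixTopGate

/-!
# The top-gate theorem for an ARBITRARY coin-entered set (blind cell PercRepro2, night-2 g27; §68.14)

`chain_XA'_six_topgate_gen`: (XA′) for `ent = {m}`, ANY `ent' ∋ j`, entry markers `x = 1[m ∈ ·]`, `y = 1[j ∈ ·]`
and the top gate `d' = d·1[{m, j} ⊆ W]` — the three set-level Ahlswede–Daykin facts of §68.11 hold verbatim on the
generic cells (their meet / join sets do not depend on `|ent'|`), so the certificate `xa_six_topgate_cert` applies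
through the generic moment identities `sixg_*`; `chain_functional_nonneg_six_topgate_gen` is the chain at every `ρ`.
-/

namespace Summit.Ventures.PercRepro2.Coin

open Classical

section TopGateGen

variable {V : Type*} [DecidableEq V] {R : Type*} [Field R] [LinearOrder R] [IsStrictOrderedRing R]

omit [LinearOrder R] [IsStrictOrderedRing R] in
/-- Splitting the clusters `{m ∈ W, j ∉ W}` into `D″` and `D*₀` (generic cells). -/
lemma sum_split_x_gen (U : Finset V) (m j : V) (ent' : Finset V) (hj : j ∈ ent') (f : Finset V → R) :
    ∑ W ∈ U.powerset.filter (fun W => m ∈ W ∧ j ∉ W), f W =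
      (∑ W ∈ U.powerset.filter (fun W => m ∈ W ∧ ¬ ∃ r ∈ ent', r ∈ W), f W)
      + (∑ W ∈ U.powerset.filter (fun W => m ∈ W ∧ j ∉ W ∧ ∃ r ∈ ent', r ∈ W), f W) := by
  simp only [Finset.sum_filter]
  rw [← Finset.sum_add_distrib]
  refine Finset.sum_congr rfl (fun W _ => ?_)
  by_cases hm : m ∈ W <;> by_cases hjW : j ∈ W <;> by_cases hex : ∃ r ∈ ent', r ∈ W
  · simp [hm, hjW, hex]
  · exact absurd ⟨j, hj, hjW⟩ hex
  · simp [hm, hjW, hex]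
  · simp [hm, hjW, hex]
  · simp [hm, hjW, hex]
  · exact absurd ⟨j, hj, hjW⟩ hex
  · simp [hm, hjW, hex]
  · simp [hm, hjW, hex]

omit [LinearOrder R] [IsStrictOrderedRing R] in
/-- Splitting the clusters `{m ∉ W, j ∉ W}` into `I₀` and `D′₀` (generic cells). -/
lemma sum_split_low_gen (U : Finset V) (m j : V) (ent' : Finset V) (hj : j ∈ ent') (f : Finset V → R) :
    ∑ W ∈ U.powerset.filter (fun W => m ∉ W ∧ j ∉ W), f W =
      (∑ W ∈ U.powerset.filter (fun W => m ∉ W ∧ ¬ ∃ r ∈ ent', r ∈ W), f W)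
      + (∑ W ∈ U.powerset.filter (fun W => m ∉ W ∧ j ∉ W ∧ ∃ r ∈ ent', r ∈ W), f W) := by
  simp only [Finset.sum_filter]
  rw [← Finset.sum_add_distrib]
  refine Finset.sum_congr rfl (fun W _ => ?_)
  by_cases hm : m ∈ W <;> by_cases hjW : j ∈ W <;> by_cases hex : ∃ r ∈ ent', r ∈ W
  · simp [hm, hjW, hex]
  · exact absurd ⟨j, hj, hjW⟩ hex
  · simp [hm, hjW, hex]
  · simp [hm, hjW, hex]
  · simp [hm, hjW, hex]
  · exact absurd ⟨j, hj, hjW⟩ hex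
  · simp [hm, hjW, hex]
  · simp [hm, hjW, hex]

/-- **THE TOP-GATE THEOREM FOR AN ARBITRARY COIN-ENTERED SET**: (XA′) `Cross ≤ a0·U001` for `ent = {m}`,
any `ent' ∋ j`, `x = 1[m ∈ ·]`, `y = 1[j ∈ ·]`, `d' = d·1[{m, j} ⊆ W]`, from `ν` lsm, `d ≤ c` and the cross
inequality `c(s)d(t) ≤ c(s∩t)d(s∪t)`. -/
theorem chain_XA'_six_topgate_gen (U : Finset V) (m j : V) (ent' : Finset V) (hj : j ∈ ent')
    (ν c d d' : Finset V → R)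
    (hν0 : ∀ W, 0 ≤ ν W) (hν : ∀ s ⊆ U, ∀ t ⊆ U, ν s * ν t ≤ ν (s ∩ t) * ν (s ∪ t))
    (hc0 : ∀ W, 0 ≤ c W) (hd0 : ∀ W, 0 ≤ d W) (hdc : ∀ W, d W ≤ c W)
    (hcd : ∀ s t, c s * d t ≤ c (s ∩ t) * d (s ∪ t))
    (hd' : ∀ W, d' W = if m ∈ W ∧ j ∈ W then d W else 0)
    (x y : Finset V → R) (hx : ∀ W, x W = if m ∈ W then 1 else 0)
    (hy : ∀ W, y W = if j ∈ W then 1 else 0) :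
    (((∑ W ∈ U.powerset, ν W * chainMix {m} ent' 0 c d W) * (∑ W ∈ U.powerset, ν W * chainMix {m} ent' 1 c d W * x W) - (∑ W ∈ U.powerset, ν W * chainMix {m} ent' 0 c d W * x W) * (∑ W ∈ U.powerset, ν W * chainMix {m} ent' 1 c d W)) *
          ((∑ W ∈ U.powerset, ν W * chainMix {m} ent' 0 c d W) * (∑ W ∈ U.powerset, ν W * chainMix {m} ent' 0 c d' W * y W) - (∑ W ∈ U.powerset, ν W * chainMix {m} ent' 0 c d W * y W) * (∑ W ∈ U.powerset, ν W * chainMix {m} ent' 0 c d' W))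
        + ((∑ W ∈ U.powerset, ν W * chainMix {m} ent' 0 c d W) * (∑ W ∈ U.powerset, ν W * chainMix {m} ent' 1 c d W * y W) - (∑ W ∈ U.powerset, ν W * chainMix {m} ent' 0 c d W * y W) * (∑ W ∈ U.powerset, ν W * chainMix {m} ent' 1 c d W)) *
          ((∑ W ∈ U.powerset, ν W * chainMix {m} ent' 0 c d W) * (∑ W ∈ U.powerset, ν W * chainMix {m} ent' 0 c d' W * x W) - (∑ W ∈ U.powerset, ν W * chainMix {m} ent' 0 c d W * x W) * (∑ W ∈ U.powerset, ν W * chainMix {m} ent' 0 c d' W))) ≤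
        (∑ W ∈ U.powerset, ν W * chainMix {m} ent' 0 c d W) * ((∑ W ∈ U.powerset, ν W * chainMix {m} ent' 0 c d W) * (∑ W ∈ U.powerset, ν W * chainMix {m} ent' 0 c d W) * (∑ W ∈ U.powerset, ν W * chainMix {m} ent' 1 c d' W * (x W * y W))
          - (∑ W ∈ U.powerset, ν W * chainMix {m} ent' 0 c d W) * (∑ W ∈ U.powerset, ν W * chainMix {m} ent' 0 c d W * y W) * (∑ W ∈ U.powerset, ν W * chainMix {m} ent' 1 c d' W * x W)
          - (∑ W ∈ U.powerset, ν W * chainMix {m} ent' 0 c d W) * (∑ W ∈ U.powerset, ν W * chainMix {m} ent' 0 c d W * x W) * (∑ W ∈ U.powerset, ν W * chainMix {m} ent' 1 c d' W * y W)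
          + (∑ W ∈ U.powerset, ν W * chainMix {m} ent' 0 c d W * x W) * (∑ W ∈ U.powerset, ν W * chainMix {m} ent' 0 c d W * y W) * (∑ W ∈ U.powerset, ν W * chainMix {m} ent' 1 c d' W)) := by
  rw [sixg_a0 U m j ent' ν c d hj, sixg_a1 U m j ent' ν c d hj x hx, sixg_a2 U m j ent' ν c d hj y hy,
    sixg_b0 U m j ent' ν c d hj, sixg_b1 U m j ent' ν c d hj x hx, sixg_b2 U m j ent' ν c d hj y hy,
    sixg_e0 U m j ent' ν c d' hj, sixg_e1 U m j ent' ν c d' hj x hx, sixg_e2 U m j ent' ν c d' hj y hy,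
    sixg_g0 U m j ent' ν c d' hj, sixg_g1 U m j ent' ν c d' hj x hx, sixg_g2 U m j ent' ν c d' hj y hy,
    sixg_g12 U m j ent' ν c d' hj x hx y hy]
  rw [topGate_cell_zero U m j ν d d' hd' (fun W => m ∉ W ∧ j ∉ W ∧ ∃ r ∈ ent', r ∈ W) (fun W h => fun h' => h.1 h'.1),
    topGate_cell_zero U m j ν d d' hd' (fun W => m ∉ W ∧ j ∈ W) (fun W h => fun h' => h.1 h'.1),
    topGate_cell_zero U m j ν d d' hd' (fun W => m ∈ W ∧ ¬ ∃ r ∈ ent', r ∈ W) (fun W h => fun h' => h.2 ⟨j, hj, h'.2⟩),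
    topGate_cell_zero U m j ν d d' hd' (fun W => m ∈ W ∧ j ∉ W ∧ ∃ r ∈ ent', r ∈ W) (fun W h => fun h' => h.2.1 h'.2),
    topGate_cell_full U m j ν d d' hd' (fun W => m ∈ W ∧ j ∈ W) (fun W h => h)]
  have hcd' : ∀ s ⊆ U, ∀ t ⊆ U, ν s * c s * (ν t * d t) ≤ ν (s ∩ t) * c (s ∩ t) * (ν (s ∪ t) * d (s ∪ t)) := by
    intro s hs t ht
    calc ν s * c s * (ν t * d t) = (ν s * ν t) * (c s * d t) := by ring
      _ ≤ (ν (s ∩ t) * ν (s ∪ t)) * (c (s ∩ t) * d (s ∪ t)) :=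
          mul_le_mul (hν s hs t ht) (hcd s t) (mul_nonneg (hc0 _) (hd0 _)) (mul_nonneg (hν0 _) (hν0 _))
      _ = _ := by ring
  have hdc' : ∀ s ⊆ U, ∀ t ⊆ U, ν s * d s * (ν t * c t) ≤ ν (s ∩ t) * c (s ∩ t) * (ν (s ∪ t) * d (s ∪ t)) := by
    intro s hs t ht
    have h := hcd t s
    rw [Finset.inter_comm, Finset.union_comm] at h
    calc ν s * d s * (ν t * c t) = (ν s * ν t) * (c t * d s) := by ring
      _ ≤ (ν (s ∩ t) * ν (s ∪ t)) * (c (s ∩ t) * d (s ∪ t)) :=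
          mul_le_mul (hν s hs t ht) h (mul_nonneg (hc0 _) (hd0 _)) (mul_nonneg (hν0 _) (hν0 _))
      _ = _ := by ring
  -- Fact 1
  have f1 := ad_sets_dec U (fun W => ν W * c W) (fun W => ν W * d W) (fun W => ν W * c W) (fun W => ν W * d W)
    (fun W => mul_nonneg (hν0 W) (hc0 W)) (fun W => mul_nonneg (hν0 W) (hd0 W))
    (fun W => mul_nonneg (hν0 W) (hc0 W)) (fun W => mul_nonneg (hν0 W) (hd0 W))
    (fun W => m ∉ W ∧ j ∈ W) (fun W => m ∈ W ∧ j ∉ W) (fun W => m ∉ W ∧ j ∉ W) (fun W => m ∈ W ∧ j ∈ W)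
    (fun s hs t ht hA hB => ⟨⟨fun h => hA.1 (Finset.mem_inter.1 h).1, fun h => hB.2 (Finset.mem_inter.1 h).2⟩,
      ⟨Finset.mem_union_right _ hB.1, Finset.mem_union_left _ hA.2⟩, hcd' s hs t ht⟩)
  -- Fact 3
  have f3 := ad_sets_dec U (fun W => ν W * c W) (fun W => ν W * d W) (fun W => ν W * c W) (fun W => ν W * d W)
    (fun W => mul_nonneg (hν0 W) (hc0 W)) (fun W => mul_nonneg (hν0 W) (hd0 W))
    (fun W => mul_nonneg (hν0 W) (hc0 W)) (fun W => mul_nonneg (hν0 W) (hd0 W))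
    (fun W => m ∉ W ∧ j ∈ W) (fun W => m ∉ W ∧ j ∉ W ∧ ∃ r ∈ ent', r ∈ W) (fun W => m ∉ W ∧ j ∉ W) (fun W => m ∉ W ∧ j ∈ W)
    (fun s hs t ht hA hB => ⟨⟨fun h => hA.1 (Finset.mem_inter.1 h).1, fun h => hB.2.1 (Finset.mem_inter.1 h).2⟩,
      ⟨fun h => (Finset.mem_union.1 h).elim hA.1 hB.1, Finset.mem_union_left _ hA.2⟩, hcd' s hs t ht⟩)
  -- Fact 2
  have f2 := ad_sets_dec U (fun W => ν W * d W) (fun W => ν W * c W) (fun W => ν W * c W) (fun W => ν W * d W)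
    (fun W => mul_nonneg (hν0 W) (hd0 W)) (fun W => mul_nonneg (hν0 W) (hc0 W))
    (fun W => mul_nonneg (hν0 W) (hc0 W)) (fun W => mul_nonneg (hν0 W) (hd0 W))
    (fun W => m ∉ W ∧ j ∉ W ∧ ∃ r ∈ ent', r ∈ W) (fun W => m ∈ W ∧ j ∉ W) (fun W => m ∉ W ∧ j ∉ W) (fun W => m ∈ W ∧ j ∉ W ∧ ∃ r ∈ ent', r ∈ W)
    (fun s hs t ht hA hB => ⟨⟨fun h => hA.1 (Finset.mem_inter.1 h).1, fun h => hB.2 (Finset.mem_inter.1 h).2⟩,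
      ⟨Finset.mem_union_right _ hB.1, fun h => (Finset.mem_union.1 h).elim hA.2.1 hB.2,
        (by obtain ⟨r, hr, hrs⟩ := hA.2.2; exact ⟨r, hr, Finset.mem_union_left _ hrs⟩)⟩, hdc' s hs t ht⟩)
  rw [sum_split_x_gen U m j ent' hj, sum_split_low_gen U m j ent' hj] at f1
  rw [sum_split_low_gen U m j ent' hj] at f3
  rw [sum_split_x_gen U m j ent' hj, sum_split_low_gen U m j ent' hj] at f2
  have hdle : (∑ W ∈ U.powerset.filter (fun W => m ∈ W ∧ ¬ ∃ r ∈ ent', r ∈ W), ν W * d W) + (∑ W ∈ U.powerset.filter (fun W => m ∈ W ∧ j ∉ W ∧ ∃ r ∈ ent', r ∈ W), ν W * d W) ≤ (∑ W ∈ U.powerset.filter (fun W => m ∈ W ∧ ¬ ∃ r ∈ ent', r ∈ W), ν W * c W) + (∑ W ∈ U.powerset.filter (fun W => m ∈ W ∧ j ∉ W ∧ ∃ r ∈ ent', r ∈ W), ν W * c W) :=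
    add_le_add (Finset.sum_le_sum (fun W _ => mul_le_mul_of_nonneg_left (hdc W) (hν0 W)))
      (Finset.sum_le_sum (fun W _ => mul_le_mul_of_nonneg_left (hdc W) (hν0 W)))
  have h2 := le_trans (mul_le_mul_of_nonneg_left hdle (cell_nonneg U ν d hν0 hd0 (fun W => m ∉ W ∧ j ∉ W ∧ ∃ r ∈ ent', r ∈ W))) f2
  linear_combination xa_six_topgate_cert _ _ _ _ _ _ _ _
    (cell_nonneg U ν c hν0 hc0 (fun W => m ∉ W ∧ ¬ ∃ r ∈ ent', r ∈ W)) (cell_nonneg U ν c hν0 hc0 (fun W => m ∉ W ∧ j ∉ W ∧ ∃ r ∈ ent', r ∈ W))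
    (cell_nonneg U ν c hν0 hc0 (fun W => m ∉ W ∧ j ∈ W)) (cell_nonneg U ν d hν0 hd0 (fun W => m ∉ W ∧ j ∉ W ∧ ∃ r ∈ ent', r ∈ W))
    (cell_nonneg U ν d hν0 hd0 (fun W => m ∉ W ∧ j ∈ W)) (cell_nonneg U ν d hν0 hd0 (fun W => m ∈ W ∧ ¬ ∃ r ∈ ent', r ∈ W))
    (cell_nonneg U ν d hν0 hd0 (fun W => m ∈ W ∧ j ∉ W ∧ ∃ r ∈ ent', r ∈ W)) (cell_nonneg U ν d hν0 hd0 (fun W => m ∈ W ∧ j ∈ W)) f1 f3 h2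

end TopGateGen

end Summit.Ventures.PercRepro2.Coin
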